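import Summits.ABC.ABC.Theorems.TwistAmplificationSharpModerateLawSpreadFlatCalibration

/-!
# Crux `TwistAmplification.SharpModerateLaw` (stmt-ABC-1975), line `unit-plane-conic-two-torsion`:
calibration of the open corner `stub_cornerLaw`

Registered sub-goal `cornerLawFlat_of_cone : FewDeepLawCone → SpreadLawCone → LawWithConeE CornerFlat 1`
(objects of `…SharpModerateLawUnitPlaneDefs.lean`, `…SharpModerateLawDefs.lean`, `…ConeDefs.lean`): the
companion line's cone few-deep law together with its promoted open core `SpreadLawCone` imply this line's corner
law `CornerLawFlat = LawWithConeE CornerFlat 1` (cone law on the Hall / bad-prime corner `m♭ < X^{−ε/4}·m_max`),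
with the constant of `indexFormShellLawCone_of_split`. So the corner is never harder than the companion's open
core; the converse direction (what the corner is REALLY worth) is the subject of the attached analysis
`cornerLaw-analysis-c3.md` on the work item.

Proof. `indexFormShellLawCone_of_split` (landed, `…SyzygyTransferCone.lean`) turns the two cone laws into the
cone law for the FULL shell population `fun _ _ _ _ => True`. Shell counts are monotone in the predicate
(`shellCount_mono`: `Set.ncard_le_ncard`, the larger slice being finite by `FewDeepSlice.finite_mplus_le` for a
maximal, hence nondegenerate, form — both slices are empty for a non-maximal form), hence so are orbit sums
(`orbitTotal_mono`, landed in `…FewDeepFlat.lean`) and total counts (`totalCount_mono`); in particular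
`totalCount (CornerFlat ε) X Y ≤ totalCount ⊤ X Y` (`totalCount_cornerFlat_le`), and the right-hand sides of
`LawWithConeE … 1` and `LawWithCone … 1` agree verbatim.
-/

noncomputable section

-- the mandated summit namespace `Summit.ABC.ABC` (summit = problem) trips the duplicate-namespace linter
set_option linter.dupNamespace false

namespace Summit.ABC.ABC.Theorems.SharpModerateLaw.UnitPlane

open Literature.NumberTheory.CubicFields
open scoped BigOperators
open Finset

/-! ## 1. Counts are monotone in the predicate -/

/-- **Shell counts are monotone in the predicate**: if `P X Y F q → Q X Y F q` on the shell of `F`, then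
`shellCount P X Y F ≤ shellCount Q X Y F` (both vanish unless `F` is maximal; for maximal `F` the `Q`-slice is
finite, being contained in `{q : Mplus F q ≤ ⌈2Y⌉₊}`, `FewDeepSlice.finite_mplus_le`). -/
theorem shellCount_mono {P Q : ℝ → ℝ → BinaryCubic ℤ → ℤ × ℤ → Prop} {X Y : ℝ} {F : BinaryCubic ℤ}
    (h : ∀ q, q ∈ ifShell F X Y → P X Y F q → Q X Y F q) : shellCount P X Y F ≤ shellCount Q X Y F := by
  unfold shellCount
  by_cases hM : RingOfForm.IsMaximal F
  · have hD : F.disc ≠ 0 := hM.disc_ne_zero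
    refine Set.ncard_le_ncard (fun q hq => ⟨hq.1, hq.2.1, h q hq.2.1 hq.2.2⟩) ?_
    exact (FewDeepSlice.finite_mplus_le hD ⌈2 * Y⌉₊).subset fun q hq => by
      have hlt : (Mplus F q : ℝ) < 2 * Y := hq.2.1.2.2.2.2.2.1
      exact_mod_cast (hlt.le.trans (Nat.le_ceil _) : (Mplus F q : ℝ) ≤ ⌈2 * Y⌉₊)
  · rw [Set.eq_empty_of_forall_notMem
        (s := {q : ℤ × ℤ | RingOfForm.IsMaximal F ∧ q ∈ ifShell F X Y ∧ P X Y F q})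
        fun q hq => hM hq.1, Set.ncard_empty]
    exact Nat.zero_le _

/-- **Total counts are monotone in the predicate** (same discriminant range, orbit by orbit via the landed
`orbitTotal_mono`). -/
theorem totalCount_mono {P Q : ℝ → ℝ → BinaryCubic ℤ → ℤ × ℤ → Prop} {X Y : ℝ}
    (h : ∀ F q, q ∈ ifShell F X Y → P X Y F q → Q X Y F q) : totalCount P X Y ≤ totalCount Q X Y := by
  unfold totalCount
  exact Finset.sum_le_sum fun D hD =>
    orbitTotal_mono (Finset.mem_erase.mp hD).1 fun F => shellCount_mono (h F)

/-- The corner count is at most the full shell count: `totalCount (CornerFlat ε) X Y ≤ totalCount ⊤ X Y`. -/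
theorem totalCount_cornerFlat_le (ε X Y : ℝ) :
    totalCount (CornerFlat ε) X Y ≤ totalCount (fun _ _ _ _ => True) X Y :=
  totalCount_mono fun _ _ _ _ => trivial

/-! ## 2. The calibration -/

/-- **The full cone shell law bounds every ε-indexed sub-population** with the same constant (the right-hand
sides of `LawWithCone ⊤ 1 = IndexFormShellLawCone` and `LawWithConeE P 1` agree verbatim). -/
theorem lawWithConeE_of_indexFormShellLawCone (P : ℝ → ℝ → ℝ → BinaryCubic ℤ → ℤ × ℤ → Prop)
    (h : IndexFormShellLawCone) : LawWithConeE P 1 := by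
  intro σ hσ ε hε
  obtain ⟨C, hC⟩ := h σ hσ ε hε
  refine ⟨C, fun X Y hX hY hc1 hc2 => ?_⟩
  have hcount : (totalCount (P ε) X Y : ℝ) ≤ (totalCount (fun _ _ _ _ => True) X Y : ℝ) := by
    exact_mod_cast totalCount_mono (P := P ε) fun _ _ _ _ => trivial
  exact hcount.trans (hC X Y hX hY hc1 hc2)

/-- **Registered sub-goal `cornerLawFlat_of_cone` of crux stmt-ABC-1975** (line `unit-plane-conic-two-torsion`):
the companion's cone few-deep law and its promoted open core `SpreadLawCone` imply the corner law
`CornerLawFlat = LawWithConeE CornerFlat 1`, with the constant of `indexFormShellLawCone_of_split`. -/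
theorem cornerLawFlat_of_cone : FewDeepLawCone → SpreadLawCone → LawWithConeE CornerFlat 1 :=
  fun h₁ h₂ => lawWithConeE_of_indexFormShellLawCone CornerFlat (indexFormShellLawCone_of_split h₁ h₂)

/-- The same calibration with the line's name for the corner: `FewDeepLawCone → SpreadLawCone → CornerLawFlat`. -/
theorem cornerLawFlat_of_cone' (h₁ : FewDeepLawCone) (h₂ : SpreadLawCone) : CornerLawFlat :=
  cornerLawFlat_of_cone h₁ h₂

end Summit.ABC.ABC.Theorems.SharpModerateLaw.UnitPlane

end
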